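import Summits.BirchSwinnertonDyer.BirchSwinnertonDyer.Theorems.CumulativeHeegnerLeopoldtRedSplitControlAtThreeShaTwoNativeAssembly
import Summits.BirchSwinnertonDyer.BirchSwinnertonDyer.Theorems.SchneiderFreeAdditiveX3PoitouTateReciprocityCanonical
import Literature.NumberTheory.GaloisRepresentations.IdeleProjectionAssembly
import Literature.NumberTheory.GaloisRepresentations.IdeleClassBarTateDualityHypotheses
import Literature.NumberTheory.GaloisRepresentations.IdeleTorusHasseCovariant
import HarnessLib

/-!
# PT2 `poitouTate_sha_tateDual K` for a TOTALLY COMPLEX `K` from the (R4) reciprocity identity and input (A) ALONE: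
# every other hypothesis of chl-p2's `poitouTate_sha_tateDual_of_localGlobal` instantiated by tree theorems

Cell `bsd-schneider`, seat `door-c4` g18.  Crux `stmt-BirchSwinnertonDyer-19295` `AnticycControlAdditiveK` (it needs PT2 =
ControlFacts (ii) only at the imaginary quadratic Heegner field, a totally complex `K`); also bsd-wall K4 (items 24200 / 20462).
Theorems only; no definition, no named fact, no instance, no `sorry`.

chl-p2 g7's `PoitouTateShaTwoReadout.poitouTate_sha_tateDual_of_localGlobal` derives `poitouTate_sha_tateDual K` (`K` totally complex) from
`hcomp, inv, hT, π, hR3, hR4, hA, hB`.  Here: `inv := classBarInv K`, `hT := tateDualityHypotheses_classBarD_classBarInv K` (door-c4 g17),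
`π := IdeleReadout.ideleProjection K` (door-c5 g17), **`hR3`** := `exists_readout_eq_of_assembly (ideleProjection K) … (ideleAssembly …)`
(door-c6 g17 + door-c5 g17; `hR3_ideleProjection`), **`hB`** := door-c5 g18's `IdeleReadout.sha_hom_units_dies_in_idele` (the idèle-torus Hasse
principle).  What remains displayed: `hcomp` (`(LocalInvariants.canonical K n).SelmerComplement` — door-c4 g18's
`selmerComplement_canonical_holds`, landing as `…PoitouTateReciprocitySumHolds`), **`hR4`** (the E-side reciprocity identity in EQUALITY form
with a bijective bridge `nat`, uniform in `y` — door-c4 lane, plan in memos/FINDING-door-c4-g18.md §2; F1 = `ExtOneDescent.extOneToH1`), and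
**`hA`** (`H²(p^*)(H²(e) c) = 0` for `c ∈ Ш²(K, M^D)` — chl-p2 g7).

* `hR3_ideleProjection` — (R3) for THE idèle projections, unconditional;
* `poitouTate_sha_tateDual_of_R4_A_B` — PT2 ⟸ `hcomp ∧ hR4 ∧ hA ∧ hB`;
* **`poitouTate_sha_tateDual_of_R4_A`** — PT2 ⟸ `hcomp ∧ hR4 ∧ hA`.

HONEST FRAMING: a reduction (displayed hypotheses); no case of Poitou–Tate (a) or of BSD is proved here; closes no item.

References: [MilneADT2006] I Thm. 4.10 (a) and proof (p. 58), Lemma 4.13; [Harari2020] Thm. 17.13 (b); [CasselsFrohlichANT1967] Ch. VII §11.2 (bis).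
-/

noncomputable section

open Function NumberField IsDedekindDomain CategoryTheory CategoryTheory.Abelian
open scoped NumberField ContRepresentation

set_option linter.dupNamespace false
set_option autoImplicit false

namespace Summit.BirchSwinnertonDyer.BirchSwinnertonDyer.Theorems.SchneiderFreeAdditiveX3.PoitouTateReduction

open Field
open Literature.NumberTheory.GaloisRepresentations Literature.NumberTheory.GaloisCohomology
open Literature.NumberTheory.GaloisRepresentations.DiscreteGaloisModule (TateDual tateDual localTatePairingZMod
  unramifiedSubgroup sha shaTwo)
open Literature.Algebra.Homology Literature.Algebra.Homology.DiscreteRep Literature.Algebra.Homology.ExtPresentation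
open Literature.NumberTheory.GaloisRepresentations.IdeleClassBar (classBarD classBarInv tateDualityHypotheses_classBarD_classBarInv)
open Literature.AnabelianGeometry.AbsoluteAnabelian.Prop121vii (zmodToQmodZ)
open Literature.NumberTheory.GaloisRepresentations.FreePresentation (presentationComplex presentationComplex_shortExact
  presModule₁ presModule₂ presProj moduleFinite_presModule₁ moduleFinite_presModule₂)
open Literature.NumberTheory.GaloisRepresentations.HomDual (IdeleProjection readout dualF homF postcompResHom
  unitsTransfer unitsToIdeleI)
open Literature.NumberTheory.GaloisRepresentations.IdeleReadout (ideleProjection ideleAssembly sha_hom_units_dies_in_idele)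
open Literature.NumberTheory.GaloisRepresentations.DGMBridge (toDGM)
open Literature.NumberTheory.GaloisRepresentations.DiscreteGaloisModule (units)
open Summit.BirchSwinnertonDyer.BirchSwinnertonDyer.Theorems.PoitouTateShaTwoReadout

variable {K : Type} [Field K] [NumberField K]

/-- **(R3) for THE idèle projections** (`π := ideleProjection K`): every admissible family of local classes `t ∈ P¹(K, M₀^D)` is the
family of readouts of one `f : N₁ ⟶ J̄` (door-c6 g17's `exists_readout_eq_of_assembly` on door-c5 g17's `ideleAssembly`).
[cite: MilneADT2006, Ch. I, Lemma 4.13 (proof)][cite: CasselsFrohlichANT1967, Ch. VII §9.7] -/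
theorem hR3_ideleProjection (n : ℕ) [NeZero n]
    {M : Type} [AddCommGroup M] [TopologicalSpace M] [DiscreteTopology M] [Finite M] [Finite (TateDual K M n)]
    (ρ₀ : DiscreteGaloisModule K M) (hM : ∀ m : M, n • m = 0) :
    ∀ T : Finset (Place K), (∀ w : InfinitePlace K, (Sum.inl w : Place K) ∈ T) →
      (∀ v : HeightOneSpectrum (𝓞 K), (Sum.inr v : Place K) ∉ T →
        ((n : ℕ) : 𝓞 K) ∉ v.asIdeal ∧ GaloisRep.IsUnramifiedAt v (ρ₀.tateDual n)) →
      ∀ t : Π v : Place K, galoisCohomology ((ρ₀.tateDual n).toLocal v) 1,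
        (∀ v : HeightOneSpectrum (𝓞 K), (Sum.inr v : Place K) ∉ T →
          t (Sum.inr v) ∈ unramifiedSubgroup (GaloisRep.toLocal v (ρ₀.tateDual n)) 1) →
        ∃ f : (presentationComplex ρ₀).X₁ ⟶ (ideleClassLimitShortComplex K).X₂,
          ∀ v : Place K, readout ρ₀ n hM (ideleProjection K v) f = t v :=
  exists_readout_eq_of_assembly (ideleProjection K) ρ₀ hM (ideleAssembly n ρ₀ hM)

/-- **PT2 `poitouTate_sha_tateDual K` (`K` totally complex) from `hcomp ∧ hR4 ∧ hA ∧ hB`** — chl-p2 g7's `poitouTate_sha_tateDual_of_localGlobal`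
with `inv := classBarInv K`, Tate duality for `(Γ_K, C̄)` (door-c4 g17), `π := ideleProjection K` and (R3) (`hR3_ideleProjection`) plugged in.
[cite: MilneADT2006, Ch. I, Thm. 4.10 (a) (proof, p. 58), Lemma 4.13][cite: Harari2020, Thm. 17.13 (b)] -/
theorem poitouTate_sha_tateDual_of_R4_A_B [IsTotallyComplex K]
    (hcomp : ∀ (n : ℕ) [NeZero n], (LocalInvariants.canonical K n).SelmerComplement)
    (hR4 : ∀ (n : ℕ) [NeZero n],
      ∀ ⦃M : Type⦄ [AddCommGroup M] [TopologicalSpace M] [DiscreteTopology M] [Finite M] [Finite (TateDual K M n)]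
      (ρ₀ : DiscreteGaloisModule K M) (hM : ∀ m : M, n • m = 0),
      ∃ nat : galoisCohomology ((ρ₀.tateDual n).tateDual n) 1 →+
          Abelian.Ext (triv (Γ := absoluteGaloisGroup K) ℤ) (presentationComplex ρ₀).X₃ 1,
        Function.Bijective nat ∧
        ∀ f : (presentationComplex ρ₀).X₁ ⟶ (ideleClassLimitShortComplex K).X₂, ∃ Tf : Finset (Place K),
          ∀ (y : galoisCohomology ((ρ₀.tateDual n).tateDual n) 1) (T' : Finset (Place K)), Tf ⊆ T' →
            (∀ v : HeightOneSpectrum (𝓞 K), (Sum.inr v : Place K) ∉ T' →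
              galoisCohomology.localization ((ρ₀.tateDual n).tateDual n) (Sum.inr v) 1 y ∈
                unramifiedSubgroup (GaloisRep.toLocal v ((ρ₀.tateDual n).tateDual n)) 1) →
            zmodToQmodZ n (∑ v ∈ T', localTatePairingZMod (ρ₀.tateDual n) n v (LocalInvariants.canonical K n v)
              (readout ρ₀ n hM (ideleProjection K v) f)
              (galoisCohomology.localization ((ρ₀.tateDual n).tateDual n) v 1 y)) =
            classBarInv K ((nat y).comp (boundary (presentationComplex_shortExact ρ₀) (classBarD K)
              (f ≫ (ideleClassLimitShortComplex K).g)) (rfl : 1 + 1 = 2)))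
    (hA : ∀ (n : ℕ) [NeZero n],
      ∀ ⦃M : Type⦄ [AddCommGroup M] [TopologicalSpace M] [DiscreteTopology M] [Finite M]
      (ρ₀ : DiscreteGaloisModule K M) (hM : ∀ m : M, n • m = 0),
        haveI := moduleFinite_presModule₂ ρ₀
        ∀ c ∈ shaTwo (ρ₀.tateDual n),
          cohomologyMap (dualF (presModule₂ ρ₀) ρ₀ (units K) (presProj ρ₀)) 2
            (cohomologyMap (HomDual.tateDualUnitsIso K ρ₀ n hM).hom 2 c) = 0)
    (hB : ∀ (n : ℕ) [NeZero n],
      ∀ ⦃M : Type⦄ [AddCommGroup M] [TopologicalSpace M] [DiscreteTopology M] [Finite M]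
      (ρ₀ : DiscreteGaloisModule K M),
        haveI := moduleFinite_presModule₁ ρ₀
        ∀ y : galoisCohomology (homGaloisModule (presModule₁ ρ₀) (units K)) 1,
          (∀ v : Place K, ContinuousCohomology.map (absGaloisRestrict K (Place.Completion v))
            (postcompResHom (presModule₁ ρ₀) (units K) (units (Place.Completion v)) (unitsTransfer K (Place.Completion v))) 1
              y = 0) →
          cohomologyMap (homF (presModule₁ ρ₀) (units K) (toDGM (ideleBarD K)) (unitsToIdeleI K)) 1 y = 0) :
    poitouTate_sha_tateDual K :=
  poitouTate_sha_tateDual_of_localGlobal hcomp (classBarInv K) (tateDualityHypotheses_classBarD_classBarInv K)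
    (ideleProjection K) (fun n _ _ _ _ _ _ _ ρ₀ hM => hR3_ideleProjection n ρ₀ hM) hR4 hA hB

/-- **PT2 `poitouTate_sha_tateDual K` (`K` totally complex) from `hcomp ∧ hR4 ∧ hA` ALONE** — input (B) is door-c5 g18's theorem
`IdeleReadout.sha_hom_units_dies_in_idele` (the idèle-torus Hasse principle for the relation lattice).  The two displayed inputs besides
`hcomp`: `hR4` = the E-side reciprocity identity in equality form with a bijective bridge `nat` (door-c4 lane), `hA` = the vanishing of
`H²(p^*)(H²(e) c)` for `c ∈ Ш²(K, M^D)` (chl-p2 lane). [cite: MilneADT2006, Ch. I, Thm. 4.10 (a) (proof, p. 58), Lemma 4.13][cite: Harari2020, Thm. 17.13 (b)] -/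
theorem poitouTate_sha_tateDual_of_R4_A [IsTotallyComplex K]
    (hcomp : ∀ (n : ℕ) [NeZero n], (LocalInvariants.canonical K n).SelmerComplement)
    (hR4 : ∀ (n : ℕ) [NeZero n],
      ∀ ⦃M : Type⦄ [AddCommGroup M] [TopologicalSpace M] [DiscreteTopology M] [Finite M] [Finite (TateDual K M n)]
      (ρ₀ : DiscreteGaloisModule K M) (hM : ∀ m : M, n • m = 0),
      ∃ nat : galoisCohomology ((ρ₀.tateDual n).tateDual n) 1 →+
          Abelian.Ext (triv (Γ := absoluteGaloisGroup K) ℤ) (presentationComplex ρ₀).X₃ 1,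
        Function.Bijective nat ∧
        ∀ f : (presentationComplex ρ₀).X₁ ⟶ (ideleClassLimitShortComplex K).X₂, ∃ Tf : Finset (Place K),
          ∀ (y : galoisCohomology ((ρ₀.tateDual n).tateDual n) 1) (T' : Finset (Place K)), Tf ⊆ T' →
            (∀ v : HeightOneSpectrum (𝓞 K), (Sum.inr v : Place K) ∉ T' →
              galoisCohomology.localization ((ρ₀.tateDual n).tateDual n) (Sum.inr v) 1 y ∈
                unramifiedSubgroup (GaloisRep.toLocal v ((ρ₀.tateDual n).tateDual n)) 1) →
            zmodToQmodZ n (∑ v ∈ T', localTatePairingZMod (ρ₀.tateDual n) n v (LocalInvariants.canonical K n v)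
              (readout ρ₀ n hM (ideleProjection K v) f)
              (galoisCohomology.localization ((ρ₀.tateDual n).tateDual n) v 1 y)) =
            classBarInv K ((nat y).comp (boundary (presentationComplex_shortExact ρ₀) (classBarD K)
              (f ≫ (ideleClassLimitShortComplex K).g)) (rfl : 1 + 1 = 2)))
    (hA : ∀ (n : ℕ) [NeZero n],
      ∀ ⦃M : Type⦄ [AddCommGroup M] [TopologicalSpace M] [DiscreteTopology M] [Finite M]
      (ρ₀ : DiscreteGaloisModule K M) (hM : ∀ m : M, n • m = 0),
        haveI := moduleFinite_presModule₂ ρ₀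
        ∀ c ∈ shaTwo (ρ₀.tateDual n),
          cohomologyMap (dualF (presModule₂ ρ₀) ρ₀ (units K) (presProj ρ₀)) 2
            (cohomologyMap (HomDual.tateDualUnitsIso K ρ₀ n hM).hom 2 c) = 0) :
    poitouTate_sha_tateDual K :=
  poitouTate_sha_tateDual_of_R4_A_B hcomp hR4 hA fun _ _ _ _ _ _ _ ρ₀ => sha_hom_units_dies_in_idele ρ₀

end Summit.BirchSwinnertonDyer.BirchSwinnertonDyer.Theorems.SchneiderFreeAdditiveX3.PoitouTateReduction

end
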